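import Summits.Langlands.Langlands.Theses.BaseFieldAscent
import Summits.Langlands.Langlands.Theorems.IrreducibilityBySelfDualityReciprocityUpToIrreducibilityCorrespondsConj
import HarnessLib

/-!
# Route BaseFieldAscent — typed decomposition of the crux `ReciprocityTRCM` (stmt-Langlands-1093)

Support file for the crux-strategist split of `BaseFieldAscent.ReciprocityTRCM` (the summit body
restricted to totally real and CM base fields, `∃ 𝓡`-shape) into three load-bearing pieces, cut along
the two seams every known engine respects:

* `X₁` — **direction (A) over CM fields**, all ranks, all weights, full local–global compatibility
  (VERBATIM the statement of item stmt-Langlands-1059 `LiftDescend.AutToGalCM` = `CMFern.AutToGalCM`;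
  open core: irregular weight);
* `X₂` — **weak direction (B) over CM fields GIVEN (A) for the same reciprocity data**: every
  irreducible geometric `ρ : Γ_F → GL_n(ℚ̄_ℓ)` (pinned Fontaine datum) is Satake–Frobenius compatible
  at almost all places with some L-algebraic cuspidal `π` (Fontaine–Mazur–Langlands over CM fields in
  its almost-everywhere form — what automorphy lifting / potential automorphy / descent deliver);
* `X₃` — **reciprocity over all CM fields ⇒ reciprocity over all totally real fields** (VERBATIM the
  route's own support item stmt-Langlands-1096 `BaseFieldAscent.ReciprocityCMtoTR`: Sorensen patching
  over imaginary-quadratic composita for (A), quadratic descent of automorphy for (B)).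

`reciprocityTRCM_of_subs : X₁ → X₂ → X₃ → ReciprocityTRCM` is the assembly, kernel-checked and
sorry-free. It is NOT a one-line seam: for a CM field the weak (B) of `X₂` is UPGRADED to the
summit's (B) (local–global compatibility at every finite place, for the same datum) by the landed
Chebotarev + Brauer–Nesbitt change-of-frame theorem
`Theorems.ReciprocityUpToIrreducibility.corresponds_of_exists_corresponds`; the totally real case is
`X₃` applied to the CM statement just assembled. `X₁`, `X₂` are written out (their decls live in other
route files / are created by the split edit); `X₃` and the conclusion are the route's decls by name.

This file closes no item (crux workfile `Cruxes/ReciprocityTRCM/Split.lean`, sorry-free; the Theorems twin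
`Theorems/BaseFieldAscentReciprocityTRCMSplit.lean` is prover-only to land). It is the intended `--glue-by` theorem of
`ledger route edit route-Langlands-BaseFieldAscent --split ReciprocityTRCM --into …`.
-/

set_option linter.dupNamespace false -- project-wide option; `Summit.Langlands.Langlands` is the mandated namespace

noncomputable section

namespace Summit.Langlands.Langlands.Cruxes.ReciprocityTRCM.Split

open Summit.Langlands.Langlands.Theses
open Filter

/-- **Assembly of the split of `ReciprocityTRCM` (stmt-Langlands-1093).**
`X₁` (= `AutToGalCM`, stmt-Langlands-1059: direction (A) over CM fields, `∃ 𝓡`) →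
`X₂` (weak direction (B) over CM fields for every datum `𝓡` carrying (A)) →
`X₃` (= `ReciprocityCMtoTR`, stmt-Langlands-1096) → `ReciprocityTRCM`.
CM fields: take `𝓡` and (A) from `X₁`, weak (B) for that `𝓡` from `X₂`, and upgrade weak (B) to (B)
with local–global compatibility at every finite place by `corresponds_of_exists_corresponds` ((A) gives
some `ρ'` corresponding to the `π` of weak (B); `ρ` is irreducible and Satake–Frobenius compatible with
the same `π`, hence corresponds too). Totally real fields: `X₃` applied to the CM case.
[folklore] -/
theorem reciprocityTRCM_of_subs
    (h₁ : ∀ (F : Type) [Field F] [NumberField F], NumberField.IsCMField F →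
      ∃ R : ReciprocityData F, ∀ n : ℕ, 0 < n →
        ∀ hcpt : Literature.NumberTheory.Automorphic.isCompact_glFiniteIntegralLevel n F,
          AutomorphicToGalois n R hcpt)
    (h₂ : ∀ (F : Type) [Field F] [NumberField F], NumberField.IsCMField F →
      ∀ R : ReciprocityData F,
        (∀ n : ℕ, 0 < n →
          ∀ hcpt : Literature.NumberTheory.Automorphic.isCompact_glFiniteIntegralLevel n F,
            AutomorphicToGalois n R hcpt) →
        ∀ (n : ℕ), 0 < n → ∀ (ℓ : ℕ) [Fact ℓ.Prime] (ι : PadicAlgCl ℓ ≃+* ℂ)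
          (ρ : Literature.NumberTheory.GaloisRepresentations.FramedGaloisRep F (PadicAlgCl ℓ) n),
          ρ.toGaloisRep.IsIrreducible → IsGeometricFramed R ρ →
            ∀ hcpt : Literature.NumberTheory.Automorphic.isCompact_glFiniteIntegralLevel n F,
              ∃ π : Literature.NumberTheory.Automorphic.CuspidalAutomorphicRepData n F hcpt,
                π.1.IsLAlgebraic ∧
                  ∀ᶠ v : IsDedekindDomain.HeightOneSpectrum (NumberField.RingOfIntegers F) in cofinite,
                    SatakeFrobCompatibleAt ι π.1 ρ v)
    (h₃ : BaseFieldAscent.ReciprocityCMtoTR) :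
    BaseFieldAscent.ReciprocityTRCM := by
  -- reciprocity (both directions, every rank) over every CM field, for the data of `X₁`
  have hCM : ∀ (F : Type) [Field F] [NumberField F], NumberField.IsCMField F →
      ∃ R : ReciprocityData F, ∀ n : ℕ, 0 < n →
        ∀ hcpt : Literature.NumberTheory.Automorphic.isCompact_glFiniteIntegralLevel n F,
          GlobalLanglandsCorrespondenceGLn n F R hcpt := by
    intro F _ _ hF
    obtain ⟨R, hA⟩ := h₁ F hF
    refine ⟨R, fun n hn hcpt => ⟨hA n hn hcpt, ?_⟩⟩
    -- weak (B) for `R` (from `X₂`) upgraded to (B) for `R`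
    intro ℓ _ ι ρ hirr hgeo
    obtain ⟨π, hL, hsat⟩ := h₂ F hF R hA n hn ℓ ι ρ hirr hgeo hcpt
    obtain ⟨ρ', -, -, hcorr', -⟩ := hA n hn hcpt π hL ℓ ι
    exact ⟨π, hL,
      Theorems.ReciprocityUpToIrreducibility.corresponds_of_exists_corresponds hirr hsat ⟨ρ', hcorr'⟩⟩
  -- totally real ∪ CM
  intro F _ _ hF
  rcases hF with hTR | hCMF
  · exact h₃ hCM F hTR
  · exact hCM F hCMF

end Summit.Langlands.Langlands.Cruxes.ReciprocityTRCM.Split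

end
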